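import Summits.NavierStokesRegularity.FluidComputer.PalasekTowerHostFields

/-!
# Host preparation, VIII: the core loop (geometry) and the calculus of its circulation integrand

Cell `ns-blowup`, seat `ns-blowup-ecbridge-3` (g0); GROUP C «BRIDGE SUPPORT» of the route
`PalasekTowerBreakdown` (crux `EpisodeBaseG`, item stmt-NavierStokesRegularity-19179, BC3 stub
`host_preparation` = the tree Prop `RungG 0`). LABEL: E–C typing (KERNEL construction). WHAT THIS
IS NOT: not Navier–Stokes evidence — plane geometry of a circle and one-variable calculus.

* §1 the CORE LOOP of the level-`0` core ledger: the circle `γ(s) = r (cos 2πs, 0, −sin 2πs)` with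
  `r = π/(2λ) = π/(4N₀)` (so `λ r = π/2`): `C¹`, closed, `‖γ‖ = r ≤ 1/N₀`, speed
  `‖γ'‖ = 2πr ≤ 8π/N₀`;
* §2 the pairing of the Beltrami wave with the loop velocity,
  `⟪wave λ (γ s), γ'(s)⟫ = 2πr · sin θ · sin((π/2) sin θ)` (`θ = 2πs`).

References: A. J. Majda, A. L. Bertozzi, *Vorticity and Incompressible Flow* (CUP 2002), §1.7
(circulation) [cite: MajdaBertozziCUP2002, §1.7]; S. Palasek, arXiv:2605.13827 §3.1 (core loops of
the tower) [cite: Palasek2026ElementaryModel, §3.1].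
-/

noncomputable section

namespace Summit.NavierStokesRegularity.FluidComputer.PalasekTowerClayBridge.Host

open Real Set Function Filter Topology InnerProductSpace Metric MeasureTheory intervalIntegral
open scoped RealInnerProductSpace ContDiff Topology ENNReal

open Literature.Analysis.FluidPDE

/-- Local notation for physical space `ℝ³ = EuclideanSpace ℝ (Fin 3)`. -/
local notation "ℝ³" => EuclideanSpace ℝ (Fin 3)

/-- Local notation for the standard basis vectors. -/
local notation "𝐞" j => EuclideanSpace.single (j : Fin 3) (1 : ℝ)

/-! ## §1 The core loop -/

/-- **The loop radius** `r = π / (2λ)` (so that `λ r = π/2`). [folklore] -/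
def loopRadius : ℝ := π / (2 * freq)

/-- `0 < r`. [folklore] -/
theorem loopRadius_pos : 0 < loopRadius := div_pos Real.pi_pos (by have := freq_pos; positivity)

/-- `λ r = π / 2`. [folklore] -/
theorem freq_mul_loopRadius : freq * loopRadius = π / 2 := by
  unfold loopRadius
  field_simp [freq_pos.ne']

/-- `r < 1`. [folklore] -/
theorem loopRadius_lt_one : loopRadius < 1 := by
  rw [loopRadius, div_lt_one (by have := freq_pos; positivity), freq]
  linarith [Real.pi_lt_four]

/-- `r ≤ 1 / N₀` (`π / 1024 ≤ 1 / 256`). [folklore] -/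
theorem loopRadius_le : loopRadius ≤ 1 / TowerRates.wide.N 0 := by
  rw [wide_N_zero, loopRadius, freq, div_le_div_iff₀ (by norm_num) (by norm_num)]
  linarith [Real.pi_lt_four]

/-- **The core loop**: the circle `s ↦ r (cos 2πs, 0, −sin 2πs)` in the `(x₀, x₂)`-plane, centred at
the origin (inside the slab's plateau). [folklore] -/
def loop (s : ℝ) : ℝ³ :=
  (loopRadius * Real.cos (2 * π * s)) • (𝐞 0) + (-(loopRadius * Real.sin (2 * π * s))) • (𝐞 2)

/-- The loop's velocity `s ↦ 2πr (−sin 2πs, 0, −cos 2πs)` (in chain-rule form). [folklore] -/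
def loopVel (s : ℝ) : ℝ³ :=
  (loopRadius * (-Real.sin (2 * π * s) * (2 * π))) • (𝐞 0) +
    (-(loopRadius * (Real.cos (2 * π * s) * (2 * π)))) • (𝐞 2)

/-- The loop is differentiable with derivative `loopVel`. [folklore] -/
theorem hasDerivAt_loop (s : ℝ) : HasDerivAt loop (loopVel s) s := by
  have h2π : HasDerivAt (fun s : ℝ => 2 * π * s) (2 * π) s := by
    simpa using (hasDerivAt_id s).const_mul (2 * π)
  exact ((h2π.cos.const_mul loopRadius).smul_const (𝐞 0)).add
    (((h2π.sin.const_mul loopRadius).neg).smul_const (𝐞 2))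

/-- `deriv loop = loopVel`. [folklore] -/
theorem deriv_loop (s : ℝ) : deriv loop s = loopVel s := (hasDerivAt_loop s).deriv

/-- The loop is `C¹` (indeed smooth). [folklore] -/
theorem contDiff_loop : ContDiff ℝ 1 loop :=
  ((contDiff_const.mul (contDiff_const.mul contDiff_id).cos).smul contDiff_const).add
    ((contDiff_const.mul (contDiff_const.mul contDiff_id).sin).neg.smul contDiff_const)

/-- The loop is closed. [folklore] -/
theorem loop_zero_eq_one : loop 0 = loop 1 := by
  simp [loop, mul_zero, mul_one, Real.cos_two_pi, Real.sin_two_pi]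

/-- Components of the loop. [folklore] -/
theorem loop_apply (s : ℝ) :
    loop s 0 = loopRadius * Real.cos (2 * π * s) ∧ loop s 1 = 0 ∧
      loop s 2 = -(loopRadius * Real.sin (2 * π * s)) := by
  refine ⟨?_, ?_, ?_⟩ <;> simp [loop]

/-- Components of the loop velocity. [folklore] -/
theorem loopVel_apply (s : ℝ) :
    loopVel s 0 = -(2 * π * loopRadius * Real.sin (2 * π * s)) ∧ loopVel s 1 = 0 ∧
      loopVel s 2 = -(2 * π * loopRadius * Real.cos (2 * π * s)) := by
  refine ⟨?_, ?_, ?_⟩ <;> simp [loopVel] <;> ring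

/-- `‖loop s‖ = r`. [folklore] -/
theorem norm_loop (s : ℝ) : ‖loop s‖ = loopRadius := by
  obtain ⟨h0, h1, h2⟩ := loop_apply s
  rw [EuclideanSpace.norm_eq, Fin.sum_univ_three, h0, h1, h2]
  have e : ‖loopRadius * Real.cos (2 * π * s)‖ ^ 2 + ‖(0 : ℝ)‖ ^ 2 +
      ‖-(loopRadius * Real.sin (2 * π * s))‖ ^ 2 = loopRadius ^ 2 := by
    simp only [Real.norm_eq_abs, sq_abs, norm_zero]
    nlinarith [Real.sin_sq_add_cos_sq (2 * π * s)]
  rw [e, Real.sqrt_sq loopRadius_pos.le]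

/-- `‖loopVel s‖ = 2πr`. [folklore] -/
theorem norm_loopVel (s : ℝ) : ‖loopVel s‖ = 2 * π * loopRadius := by
  obtain ⟨h0, h1, h2⟩ := loopVel_apply s
  rw [EuclideanSpace.norm_eq, Fin.sum_univ_three, h0, h1, h2]
  have e : ‖-(2 * π * loopRadius * Real.sin (2 * π * s))‖ ^ 2 + ‖(0 : ℝ)‖ ^ 2 +
      ‖-(2 * π * loopRadius * Real.cos (2 * π * s))‖ ^ 2 = (2 * π * loopRadius) ^ 2 := by
    simp only [Real.norm_eq_abs, sq_abs, norm_zero]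
    nlinarith [Real.sin_sq_add_cos_sq (2 * π * s)]
  rw [e, Real.sqrt_sq (by have := loopRadius_pos; positivity)]

/-- The loop stays in `B̄(0, 1/N₀)`. [folklore] -/
theorem loop_mem_closedBall (s : ℝ) :
    loop s ∈ Metric.closedBall (0 : ℝ³) (1 / TowerRates.wide.N 0) := by
  rw [Metric.mem_closedBall, dist_zero_right, norm_loop]
  exact loopRadius_le

/-- The loop's speed is at most `8π/N₀` (`2πr = π²/512 ≤ 8π/256`). [folklore] -/
theorem norm_deriv_loop_le (s : ℝ) : ‖deriv loop s‖ ≤ 8 * π / TowerRates.wide.N 0 := by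
  rw [deriv_loop, norm_loopVel, wide_N_zero, loopRadius, freq]
  have hπ := Real.pi_pos
  rw [show 2 * π * (π / (2 * 512)) = π * π / 512 by ring, div_le_div_iff₀ (by norm_num) (by norm_num)]
  nlinarith [Real.pi_lt_four]

/-! ## §2 The circulation integrand: the wave pairing -/

/-- The wave's pairing with the loop velocity: `⟪wave λ (γ s), γ'(s)⟫ = 2πr sin θ sin((π/2) sin θ)`,
`θ = 2πs` (the plane of the loop contains the wave's `e₀`-component, and `λ r = π/2`). [folklore] -/
theorem inner_wave_loopVel (s : ℝ) :
    ⟪wave freq (loop s), loopVel s⟫ =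
      2 * π * loopRadius * (Real.sin (2 * π * s) * Real.sin (π / 2 * Real.sin (2 * π * s))) := by
  obtain ⟨h0, h1, h2⟩ := loopVel_apply s
  obtain ⟨-, -, l2⟩ := loop_apply s
  have hw0 : wave freq (loop s) 0 = -Real.sin (π / 2 * Real.sin (2 * π * s)) := by
    rw [wave_apply_zero, l2, show freq * -(loopRadius * Real.sin (2 * π * s)) =
      -(π / 2 * Real.sin (2 * π * s)) by rw [← freq_mul_loopRadius]; ring, Real.sin_neg]
  rw [PiLp.inner_apply, Fin.sum_univ_three, hw0, wave_apply_one, wave_apply_two, h0, h1, h2]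
  simp only [RCLike.inner_apply, conj_trivial]
  ring

end Summit.NavierStokesRegularity.FluidComputer.PalasekTowerClayBridge.Host

end
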